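import Literature.AnabelianGeometry.AbsoluteAnabelian.ProfiniteOuterSemidirectProduct
import HarnessLib

/-!
# Naturality of the profinite `G ⋊^out J` in `J` ([SemiAnbd] §0 p. 5; [AbsTopII] Def 1.2 (ii), open subgroups `H' ⊆ H`)

Mochizuki, *Semi-graphs of anabelioids*, Publ. RIMS **42** (2006), §0 p. 5 (`G ⋊^out J` is "the
fiber product of `Aut(G) → Out(G)` and `J → Out(G)`", hence natural in `J`) [cite: MochizukiSemiAnbd2006, §0 p.5];
used in [AbsTopII] §1 whenever one passes from `H` to a closed subgroup `H' ⊆ H ⊆ Out(Π_𝔾)`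
(`Π_{H'} ⊆ Π_H`).

Companion of `ProfiniteOuterSemidirectProduct.lean` (abc-iut cell, GAP row «G-P13-GR», abc-iut-w5-d151 g4).
For a continuous homomorphism `f : J' →ₜ* J` and `θ : J →ₜ* outProfinite hG`:

* `outerSemidirectProfiniteMap hG θ f : outerSemidirectProfinite hG (θ.comp f) →ₜ* outerSemidirectProfinite hG θ`,
  `(a, j') ↦ (a, f j')` — a continuous homomorphism over `f` (`sndProfinite_map`) and under `G`
  (`map_inlProfinite`);
* it is injective when `f` is (`outerSemidirectProfiniteMap_injective`), and its range is the preimage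
  `snd⁻¹(range f)` (`range_outerSemidirectProfiniteMap`) — i.e. `G ⋊^out J'` IS the fibre product
  `(G ⋊^out J) ×_J J'`; for a closed subgroup `H' ≤ H` this is `Π_{H'} = Π_H ×_H H'`;
* the [AbsTopII] Def 1.2 (ii) input form: for a CLOSED subgroup `H ⊆ Out(G)` (= `outProfinite hG`),
  `outerActionOfClosedSubgroup hG H : H →ₜ* outProfinite hG` and
  `outerSemidirectProfiniteOfClosedSubgroup hG H : ProfiniteGrp` (= `Π_𝔾 ⋊^out H`), with the inclusions
  `closedSubgroupInclusion` for `H' ≤ H` (compatible outer actions: `outerActionOfClosedSubgroup_comp`).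

Nothing here bears on [IUTchIII] Cor. 3.12.
-/

namespace Literature.AnabelianGeometry.AbsoluteAnabelian

open Literature.AnabelianGeometry.EtaleTheta Literature.AnabelianGeometry.SemiGraphs
open Topology

universe u

variable {G : Type u} [Group G] [TopologicalSpace G] [IsTopologicalGroup G] [CompactSpace G]
  [TotallyDisconnectedSpace G] (hG : IsTopologicallyFinitelyGenerated G)
  {J : Type u} [Group J] [TopologicalSpace J] [IsTopologicalGroup J] [CompactSpace J]
  [TotallyDisconnectedSpace J] (θ : J →ₜ* outProfinite hG)
  {J' : Type u} [Group J'] [TopologicalSpace J'] [IsTopologicalGroup J'] [CompactSpace J']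
  [TotallyDisconnectedSpace J'] (f : J' →ₜ* J)

/-- **Naturality of `G ⋊^out J` in `J`**: `(a, j') ↦ (a, f j')` is a continuous homomorphism
`G ⋊^out_{θ ∘ f} J' → G ⋊^out_θ J`. [cite: MochizukiSemiAnbd2006, §0 p.5] -/
noncomputable def outerSemidirectProfiniteMap :
    outerSemidirectProfinite hG (θ.comp f) →ₜ* outerSemidirectProfinite hG θ where
  toFun p := ⟨(p.1.1, f p.1.2), by
    rw [mem_outerSemidirectSubgroup_iff]
    exact p.2⟩
  map_one' := Subtype.ext (Prod.ext rfl (map_one f))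
  map_mul' p q := Subtype.ext (Prod.ext rfl (map_mul f p.1.2 q.1.2))
  continuous_toFun := by
    refine Continuous.subtype_mk ?_ _
    exact (continuous_fst.comp continuous_subtype_val).prodMk
      (f.continuous.comp (continuous_snd.comp continuous_subtype_val))

/-- Components of the naturality map. [cite: MochizukiSemiAnbd2006, §0 p.5] -/
@[simp] theorem outerSemidirectProfiniteMap_apply (p : outerSemidirectProfinite hG (θ.comp f)) :
    ((outerSemidirectProfiniteMap hG θ f p).1 : profiniteAut hG × J) = (p.1.1, f p.1.2) := rfl

/-- The naturality map lies OVER `f`: `snd ∘ map = f ∘ snd`. [cite: MochizukiSemiAnbd2006, §0 p.5] -/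
@[simp] theorem sndProfinite_map (p : outerSemidirectProfinite hG (θ.comp f)) :
    sndProfinite hG θ (outerSemidirectProfiniteMap hG θ f p) = f (sndProfinite hG (θ.comp f) p) := rfl

/-- The naturality map lies UNDER `G`: `map ∘ inl' = inl`. [cite: MochizukiSemiAnbd2006, §0 p.5] -/
@[simp] theorem map_inlProfinite (g : G) :
    outerSemidirectProfiniteMap hG θ f (inlProfinite hG (θ.comp f) g) = inlProfinite hG θ g :=
  Subtype.ext (Prod.ext rfl (map_one f))

/-- **The naturality map is injective when `f` is** (e.g. `f` the inclusion of a closed subgroup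
`H' ≤ H`). [cite: MochizukiSemiAnbd2006, §0 p.5] -/
theorem outerSemidirectProfiniteMap_injective (hf : Function.Injective f) :
    Function.Injective (outerSemidirectProfiniteMap hG θ f) := by
  intro p q hpq
  have h := congrArg (fun r : outerSemidirectProfinite hG θ => (r.1 : profiniteAut hG × J)) hpq
  simp only [outerSemidirectProfiniteMap_apply, Prod.mk.injEq] at h
  exact Subtype.ext (Prod.ext h.1 (hf h.2))

/-- **`G ⋊^out J'` is the fibre product `(G ⋊^out J) ×_J J'`**: the range of the naturality map is the
preimage of `range f` under `snd`. [cite: MochizukiSemiAnbd2006, §0 p.5] -/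
theorem range_outerSemidirectProfiniteMap :
    (outerSemidirectProfiniteMap hG θ f).toMonoidHom.range =
      (f.toMonoidHom.range).comap (sndProfinite hG θ).toMonoidHom := by
  ext p
  constructor
  · rintro ⟨q, rfl⟩
    exact ⟨q.1.2, rfl⟩
  · rintro ⟨j', hj'⟩
    have hj : f j' = p.1.2 := hj'
    refine ⟨⟨(p.1.1, j'), ?_⟩, Subtype.ext (Prod.ext rfl hj)⟩
    rw [mem_outerSemidirectSubgroup_iff]
    change outProj hG p.1.1 = θ (f j')
    rw [hj]
    exact p.2

/-- For INJECTIVE `f`, `G ⋊^out J' → G ⋊^out J` is a closed embedding (continuous injection of a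
compact space into a Hausdorff space) — `Π_{H'} ⊆ Π_H` as a closed subgroup.
[cite: MochizukiSemiAnbd2006, §0 p.5] -/
theorem isClosedEmbedding_outerSemidirectProfiniteMap (hf : Function.Injective f) :
    Topology.IsClosedEmbedding (outerSemidirectProfiniteMap hG θ f) :=
  (outerSemidirectProfiniteMap hG θ f).continuous.isClosedEmbedding
    (outerSemidirectProfiniteMap_injective hG θ f hf)

/-! ### Closed subgroups `H ⊆ Out(G)` ([AbsTopII] Def 1.2 (ii): `Π_H := Π_𝔾 ⋊^out H`) -/

section ClosedSubgroup

variable {G : Type u} [Group G] [TopologicalSpace G] [IsTopologicalGroup G] [CompactSpace G]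
  [TotallyDisconnectedSpace G] (hG : IsTopologicallyFinitelyGenerated G)
  (H : ClosedSubgroup (outProfinite hG))

/-- The inclusion of a closed subgroup `H ⊆ Out(G)` as a continuous homomorphism (the outer action of
[AbsTopII] Def 1.2 (ii)). [cite: MochizukiAbsTopII2013, Def 1.2 (ii) p.10] -/
noncomputable def outerActionOfClosedSubgroup : H.toSubgroup →ₜ* outProfinite hG :=
  ⟨H.toSubgroup.subtype, continuous_subtype_val⟩

/-- `outerActionOfClosedSubgroup` is the inclusion. [cite: MochizukiAbsTopII2013, Def 1.2 (ii) p.10] -/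
@[simp] theorem outerActionOfClosedSubgroup_apply (h : H.toSubgroup) :
    outerActionOfClosedSubgroup hG H h = h.1 := rfl

/-- A closed subgroup of the profinite `Out(G)` is compact. [cite: MochizukiAbsTopII2013, Def 1.2 (ii) p.10] -/
theorem compactSpace_closedSubgroup : CompactSpace H.toSubgroup :=
  isCompact_iff_compactSpace.mp H.isClosed'.isCompact

/-- **`Π_H := Π_𝔾 ⋊^out H` for a CLOSED subgroup `H ⊆ Out(Π_𝔾)`** as a profinite group (a closed subgroup of
a profinite group is profinite; then `outerSemidirectProfinite` at the inclusion).  By definition this is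
`outerSemidirectProfinite hG (outerActionOfClosedSubgroup hG H)` (under `compactSpace_closedSubgroup`), so
every result of `ProfiniteOuterSemidirectProduct*.lean` applies to it verbatim.
[cite: MochizukiAbsTopII2013, Def 1.2 (ii) p.10] -/
noncomputable def outerSemidirectProfiniteOfClosedSubgroup : ProfiniteGrp.{u} :=
  haveI : CompactSpace H.toSubgroup := compactSpace_closedSubgroup hG H
  outerSemidirectProfinite hG (outerActionOfClosedSubgroup hG H)

/-- For nested closed subgroups `H' ≤ H ⊆ Out(G)`: the inclusion `H' → H` as a continuous homomorphism,
along which `outerSemidirectProfiniteMap` gives `Π_{H'} ⊆ Π_H`. [cite: MochizukiAbsTopII2013, Def 1.2 (ii) p.10] -/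
noncomputable def closedSubgroupInclusion {H' H : ClosedSubgroup (outProfinite hG)} (hle : H' ≤ H) :
    H'.toSubgroup →ₜ* H.toSubgroup :=
  ⟨Subgroup.inclusion hle, continuous_inclusion hle⟩

/-- The inclusion is injective. [cite: MochizukiAbsTopII2013, Def 1.2 (ii) p.10] -/
theorem closedSubgroupInclusion_injective {H' H : ClosedSubgroup (outProfinite hG)} (hle : H' ≤ H) :
    Function.Injective (closedSubgroupInclusion hG hle) :=
  Subgroup.inclusion_injective hle

/-- The outer actions are compatible: `θ_H ∘ incl = θ_{H'}`. [cite: MochizukiAbsTopII2013, Def 1.2 (ii) p.10] -/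
theorem outerActionOfClosedSubgroup_comp {H' H : ClosedSubgroup (outProfinite hG)} (hle : H' ≤ H) :
    (outerActionOfClosedSubgroup hG H).comp (closedSubgroupInclusion hG hle) =
      outerActionOfClosedSubgroup hG H' := by
  ext h; rfl

end ClosedSubgroup

end Literature.AnabelianGeometry.AbsoluteAnabelian
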